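import Summits.QuantumFields.YangMills.Theorems.LangevinControlUVFemtoCurvatureSkewnessCDominanceBridges

/-!
# Crux `FemtoCurvatureSkewnessC` (stmt-QuantumFields-16205), line `ratio-transport`: the PROMOTABLE ITEM TEXTS in route vocabulary

Lead `prover-line-stmt-QuantumFields-16205-c3-0` (line lead, cycle 4, 2026-08-16).  For the planners who act on the lead's `promote-stub`
verdict: the two candidate physics items written EXACTLY as a route decl of `Theses/LangevinControlUV.lean` would have to state them
(`open Literature.MathematicalPhysics.QuantumFieldTheory in ∀ G …, IsCompactSimpleLieGroup G → letI … borel …; ∀ r, (∃ a, Continuous a ∧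
⟨two-point package, verbatim the crux's⟩) → ∃ a, Continuous a ∧ ⟨package⟩ ∧ ⟨new clause⟩`, Literature + Mathlib vocabulary only — no
`Theorems`-side name occurs in the bodies), together with kernel-checked bridges to the line's registered stub and to the crux:

* `FemtoSkewnessTreeDominanceItem` — ENGINE form (recommended ITEM): tree dominance of `κ₃(P_0^{01},P_{ne₂}^{01},P_{ne₃}^{01})` and
  `Cov(P_0^{01},P_{ne₂}^{01})` with ONE coupling factor `λ = λ(L,β,n) > 0` and a FIXED relative error `θ < 1` on the femto boxes of some
  continuous package map (`8dλ³G_a²G_d`, `2dλ²G_a²`; `G_a`, `G_d` the explicit zero-mode-free transverse torus propagator sums of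
  `PerpPropagatorPos`).  `treeDominanceItem_iff_pressureDominanceC : FemtoSkewnessTreeDominanceItem ↔ PressureDominanceC` (the landed
  `PressureCGF` identities `∂³ log Z = −κ₃`, `∂² log Z = Cov`), hence `femtoCurvatureSkewnessC_of_treeDominanceItem`.
* `FemtoSkewRatioFloorItem` — COROLLARY form: a positive floor `u₁` of the tree-normalised ratio `κ₃·G_a/(Cov^{3/2}·G_d)` on the femto
  boxes of some continuous package map.  `ratioFloorItem_iff_ratioFloorC : FemtoSkewRatioFloorItem ↔ RatioFloorC` (= the registered stub
  `Sig.stub_ratioFloorC`; `←` trivially, `→` by the landed ruler rigidity), `ratioFloorItem_of_treeDominanceItem`,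
  `femtoCurvatureSkewnessC_of_ratioFloorItem`.

Nothing is asserted; the two `def … : Prop` are route-posited statement TEXTS (candidates for a planner-filed item), not literature facts,
and neither restates the crux (both pin the tree SHAPE of `κ₃`, which the crux's free `Γ₃` does not).
-/

set_option autoImplicit false

noncomputable section

namespace Summit.QuantumFields.YangMills.Cruxes.FemtoCurvatureSkewnessC.RatioTransport

open MeasureTheory Filter Topology
open Literature.MathematicalPhysics.QuantumFieldTheory
open Summit.QuantumFields.YangMills.Theorems.FemtoCurvatureSkewness.Negative (kappa3 TwoPointPackage SkewnessPackage)
open Summit.QuantumFields.YangMills.Cruxes.FemtoCurvatureSkewness.CouplingCubicResponse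
  (covAxis torusPropAxis torusPropDiag PressureDominance pressureCGF_holds D3 D2)
open Summit.QuantumFields.YangMills.Theses.LangevinControlUV (FemtoCurvatureSkewnessC)
open Summit.QuantumFields.YangMills.Theorems.FemtoCurvatureSkewnessC.Negative (continuous_package_maps_comparable)

/-- **Candidate item (ENGINE form), route vocabulary: femto tree dominance of the plaquette skewness and axis covariance at a continuous
package map.**  For every compact simple `G` and lattice representation `r`: IF some continuous unit map carries the femto two-point package,
THEN some continuous unit map `a` carries the package AND there are `β₁`, `ℓ₁ > 0`, `0 ≤ θ < 1`, `d > 0` such that on every femto torus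
`L·a(β) ≤ ℓ₁`, `β ≥ β₁`, for `1 ≤ n ≤ L/8`, SOME `λ > 0` has `|κ₃ − 8dλ³G_a²G_d| ≤ θ·8dλ³G_a²G_d` and `|Cov − 2dλ²G_a²| ≤ θ·2dλ²G_a²`
(`κ₃ = κ₃(P_0^{01},P_{ne₂}^{01},P_{ne₃}^{01})`, `Cov = Cov(P_0^{01},P_{ne₂}^{01})`, `G_a`/`G_d` = the zero-mode-free transverse torus
propagator at the axis / diagonal displacement).  Equivalent to `PressureDominanceC` (`treeDominanceItem_iff_pressureDominanceC`). -/
def FemtoSkewnessTreeDominanceItem : Prop :=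
open Literature.MathematicalPhysics.QuantumFieldTheory in ∀ (G : Type) [Group G] [TopologicalSpace G] [IsTopologicalGroup G] [CompactSpace G], IsCompactSimpleLieGroup G → letI : MeasurableSpace G := borel G; haveI : BorelSpace G := ⟨rfl⟩; ∀ (r : LatticeRep G), (∃ (a : ℝ → ℝ), Continuous a ∧ (∃ (Γ : ℝ → ℝ) (β₀ ℓ₀ c C : ℝ), 0 < ℓ₀ ∧ 0 < c ∧ (∀ β, 0 < a β) ∧ Filter.Tendsto a Filter.atTop (nhds 0) ∧ (∀ s : ℝ, 0 < s → s ≤ ℓ₀ → 0 < Γ s ∧ Γ s ≤ 1) ∧ ∀ (L : ℕ) [NeZero L] (β : ℝ), β₀ ≤ β → (L : ℝ) * a β ≤ ℓ₀ → let P : (Fin 4 → ZMod L) → Fin 4 → Fin 4 → GaugeConfig 4 L G → ℝ := fun x i j U => (r.N : ℝ) - (r.ρ (plaquetteHolonomy U x i j)).trace.re; let E : (GaugeConfig 4 L G → ℝ) → ℝ := fun F => wilsonExpectation (d := 4) (L := L) r.ρ β F; let cov : (GaugeConfig 4 L G → ℝ) → (GaugeConfig 4 L G → ℝ) → ℝ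 := fun F F' => E (fun U => F U * F' U) - E F * E F'; let dist : (Fin 4 → ZMod L) → (Fin 4 → ZMod L) → ℝ := fun x y => Real.sqrt (∑ k : Fin 4, (((x k - y k).valMinAbs : ℤ) : ℝ) ^ 2); (∀ n : ℕ, 1 ≤ n → 8 * n ≤ L → c * Γ ((n : ℝ) * a β) ≤ (n : ℝ) ^ 8 * cov (P 0 0 1) (P (Pi.single (2 : Fin 4) ((n : ℕ) : ZMod L)) 0 1) ∧ (n : ℝ) ^ 8 * cov (P 0 0 1) (P (Pi.single (2 : Fin 4) ((n : ℕ) : ZMod L)) 0 1) ≤ C * Γ ((n : ℝ) * a β)) ∧ (∀ (x y : Fin 4 → ZMod L) (i j i' j' : Fin 4), x ≠ y → i ≠ j → i' ≠ j' → |cov (P x i j) (P y i' j')| * dist x y ^ 8 ≤ C * Γ (dist x y * a β)))) → ∃ (a : ℝ → ℝ), Continuous a ∧ (∃ (Γ : ℝ → ℝ) (β₀ ℓ₀ c C : ℝ), 0 < ℓ₀ ∧ 0 < c ∧ (∀ β, 0 < a β) ∧ Filter.Tendsto a Filter.atTop (nhds 0) ∧ (∀ s : ℝ, 0 < s → s ≤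 ℓ₀ → 0 < Γ s ∧ Γ s ≤ 1) ∧ ∀ (L : ℕ) [NeZero L] (β : ℝ), β₀ ≤ β → (L : ℝ) * a β ≤ ℓ₀ → let P : (Fin 4 → ZMod L) → Fin 4 → Fin 4 → GaugeConfig 4 L G → ℝ := fun x i j U => (r.N : ℝ) - (r.ρ (plaquetteHolonomy U x i j)).trace.re; let E : (GaugeConfig 4 L G → ℝ) → ℝ := fun F => wilsonExpectation (d := 4) (L := L) r.ρ β F; let cov : (GaugeConfig 4 L G → ℝ) → (GaugeConfig 4 L G → ℝ) → ℝ := fun F F' => E (fun U => F U * F' U) - E F * E F'; let dist : (Fin 4 → ZMod L) → (Fin 4 → ZMod L) → ℝ := fun x y => Real.sqrt (∑ k : Fin 4, (((x k - y k).valMinAbs : ℤ) : ℝ) ^ 2); (∀ n : ℕ, 1 ≤ n → 8 * n ≤ L → c * Γ ((n : ℝ) * a β) ≤ (n : ℝ) ^ 8 * cov (P 0 0 1) (P (Pi.single (2 : Fin 4) ((n : ℕ) : ZMod L)) 0 1) ∧ (n : ℝ) ^ 8 * cov (P 0 0 1) (P (Pi.single (2 : Fin 4) ((n : ℕ) : ZMod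 L)) 0 1) ≤ C * Γ ((n : ℝ) * a β)) ∧ (∀ (x y : Fin 4 → ZMod L) (i j i' j' : Fin 4), x ≠ y → i ≠ j → i' ≠ j' → |cov (P x i j) (P y i' j')| * dist x y ^ 8 ≤ C * Γ (dist x y * a β))) ∧ (∃ (β₁ ℓ₁ θ d : ℝ), 0 < ℓ₁ ∧ 0 ≤ θ ∧ θ < 1 ∧ 0 < d ∧ ∀ (L : ℕ) [NeZero L] (β : ℝ), β₁ ≤ β → (L : ℝ) * a β ≤ ℓ₁ → let P : (Fin 4 → ZMod L) → Fin 4 → Fin 4 → GaugeConfig 4 L G → ℝ := fun x i j U => (r.N : ℝ) - (r.ρ (plaquetteHolonomy U x i j)).trace.re; let E : (GaugeConfig 4 L G → ℝ) → ℝ := fun F => wilsonExpectation (d := 4) (L := L) r.ρ β F; let cov : (GaugeConfig 4 L G → ℝ) → (GaugeConfig 4 L G → ℝ) → ℝ := fun F F' => E (fun U => F U * F' U) - E F * E F'; ∀ n : ℕ, 1 ≤ n → 8 * n ≤ L → let Ga : ℝ := ∑ k : Fin 4 → ZMod L, (if k = 0 then 0 else ((2 - 2 * Real.cos (2 * Real.pi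 * ((k 0).val : ℝ) / L)) + (2 - 2 * Real.cos (2 * Real.pi * ((k 1).val : ℝ) / L))) / ((2 - 2 * Real.cos (2 * Real.pi * ((k 0).val : ℝ) / L)) + (2 - 2 * Real.cos (2 * Real.pi * ((k 1).val : ℝ) / L)) + (2 - 2 * Real.cos (2 * Real.pi * ((k 2).val : ℝ) / L)) + (2 - 2 * Real.cos (2 * Real.pi * ((k 3).val : ℝ) / L)))) * Real.cos (2 * Real.pi * ((k 2).val : ℝ) * n / L); let Gd : ℝ := ∑ k : Fin 4 → ZMod L, (if k = 0 then 0 else ((2 - 2 * Real.cos (2 * Real.pi * ((k 0).val : ℝ) / L)) + (2 - 2 * Real.cos (2 * Real.pi * ((k 1).val : ℝ) / L))) / ((2 - 2 * Real.cos (2 * Real.pi * ((k 0).val : ℝ) / L)) + (2 - 2 * Real.cos (2 * Real.pi * ((k 1).val : ℝ) / L)) + (2 - 2 * Real.cos (2 * Real.pi * ((k 2).val : ℝ) / L)) + (2 - 2 * Real.cos (2 * Real.pi * ((k 3).val : ℝ) / L)))) * Real.cos (2 * Real.pi * (((k 3).val : ℝ) - ((k 2).val : ℝ)) * n / L); let K3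 : ℝ := E (fun U => P 0 0 1 U * P (Pi.single (2 : Fin 4) ((n : ℕ) : ZMod L)) 0 1 U * P (Pi.single (3 : Fin 4) ((n : ℕ) : ZMod L)) 0 1 U) - E (P 0 0 1) * cov (P (Pi.single (2 : Fin 4) ((n : ℕ) : ZMod L)) 0 1) (P (Pi.single (3 : Fin 4) ((n : ℕ) : ZMod L)) 0 1) - E (P (Pi.single (2 : Fin 4) ((n : ℕ) : ZMod L)) 0 1) * cov (P 0 0 1) (P (Pi.single (3 : Fin 4) ((n : ℕ) : ZMod L)) 0 1) - E (P (Pi.single (3 : Fin 4) ((n : ℕ) : ZMod L)) 0 1) * cov (P 0 0 1) (P (Pi.single (2 : Fin 4) ((n : ℕ) : ZMod L)) 0 1) - E (P 0 0 1) * E (P (Pi.single (2 : Fin 4) ((n : ℕ) : ZMod L)) 0 1) * E (P (Pi.single (3 : Fin 4) ((n : ℕ) : ZMod L)) 0 1); let C2 : ℝ := cov (P 0 0 1) (P (Pi.single (2 : Fin 4) ((n : ℕ) : ZMod L)) 0 1); ∃ lam : ℝ, 0 < lam ∧ |K3 - 8 * d * lam ^ 3 * (Ga ^ 2 * Gd)|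 ≤ θ * (8 * d * lam ^ 3 * (Ga ^ 2 * Gd)) ∧ |C2 - 2 * d * lam ^ 2 * Ga ^ 2| ≤ θ * (2 * d * lam ^ 2 * Ga ^ 2))

/-- **Candidate item (COROLLARY form), route vocabulary: a positive floor of the tree-normalised skewness ratio at a continuous package
map.**  For every compact simple `G` and `r`: IF some continuous unit map carries the femto two-point package, THEN some continuous unit map
`a` carries the package AND there are `β₁`, `ℓ₁ > 0`, `u₁ > 0` with `u₁ ≤ κ₃·G_a/(Cov^{3/2}·G_d)` on every femto torus `L·a(β) ≤ ℓ₁`, `β ≥ β₁`,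
`1 ≤ n ≤ L/8`.  Equivalent to the registered stub `RatioFloorC` (`ratioFloorItem_iff_ratioFloorC`). -/
def FemtoSkewRatioFloorItem : Prop :=
open Literature.MathematicalPhysics.QuantumFieldTheory in ∀ (G : Type) [Group G] [TopologicalSpace G] [IsTopologicalGroup G] [CompactSpace G], IsCompactSimpleLieGroup G → letI : MeasurableSpace G := borel G; haveI : BorelSpace G := ⟨rfl⟩; ∀ (r : LatticeRep G), (∃ (a : ℝ → ℝ), Continuous a ∧ (∃ (Γ : ℝ → ℝ) (β₀ ℓ₀ c C : ℝ), 0 < ℓ₀ ∧ 0 < c ∧ (∀ β, 0 < a β) ∧ Filter.Tendsto a Filter.atTop (nhds 0) ∧ (∀ s : ℝ, 0 < s → s ≤ ℓ₀ → 0 < Γ s ∧ Γ s ≤ 1) ∧ ∀ (L : ℕ) [NeZero L] (β : ℝ), β₀ ≤ β → (L : ℝ) * a β ≤ ℓ₀ → let P : (Fin 4 → ZMod L) → Fin 4 → Fin 4 → GaugeConfig 4 L G → ℝ := fun x i j U => (r.N : ℝ) - (r.ρ (plaquetteHolonomy U x i j)).trace.re; let E : (GaugeConfig 4 L G → ℝ)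 → ℝ := fun F => wilsonExpectation (d := 4) (L := L) r.ρ β F; let cov : (GaugeConfig 4 L G → ℝ) → (GaugeConfig 4 L G → ℝ) → ℝ := fun F F' => E (fun U => F U * F' U) - E F * E F'; let dist : (Fin 4 → ZMod L) → (Fin 4 → ZMod L) → ℝ := fun x y => Real.sqrt (∑ k : Fin 4, (((x k - y k).valMinAbs : ℤ) : ℝ) ^ 2); (∀ n : ℕ, 1 ≤ n → 8 * n ≤ L → c * Γ ((n : ℝ) * a β) ≤ (n : ℝ) ^ 8 * cov (P 0 0 1) (P (Pi.single (2 : Fin 4) ((n : ℕ) : ZMod L)) 0 1) ∧ (n : ℝ) ^ 8 * cov (P 0 0 1) (P (Pi.single (2 : Fin 4) ((n : ℕ) : ZMod L)) 0 1) ≤ C * Γ ((n : ℝ) * a β)) ∧ (∀ (x y : Fin 4 → ZMod L) (i j i' j' : Fin 4), x ≠ y → i ≠ j → i' ≠ j' → |cov (P x i j) (P y i' j')| * dist x y ^ 8 ≤ C * Γ (dist x y * a β)))) → ∃ (a : ℝ → ℝ), Continuous a ∧ (∃ (Γ : ℝ → ℝ) (β₀ ℓ₀ c C : ℝ), 0 <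 ℓ₀ ∧ 0 < c ∧ (∀ β, 0 < a β) ∧ Filter.Tendsto a Filter.atTop (nhds 0) ∧ (∀ s : ℝ, 0 < s → s ≤ ℓ₀ → 0 < Γ s ∧ Γ s ≤ 1) ∧ ∀ (L : ℕ) [NeZero L] (β : ℝ), β₀ ≤ β → (L : ℝ) * a β ≤ ℓ₀ → let P : (Fin 4 → ZMod L) → Fin 4 → Fin 4 → GaugeConfig 4 L G → ℝ := fun x i j U => (r.N : ℝ) - (r.ρ (plaquetteHolonomy U x i j)).trace.re; let E : (GaugeConfig 4 L G → ℝ) → ℝ := fun F => wilsonExpectation (d := 4) (L := L) r.ρ β F; let cov : (GaugeConfig 4 L G → ℝ) → (GaugeConfig 4 L G → ℝ) → ℝ := fun F F' => E (fun U => F U * F' U) - E F * E F'; let dist : (Fin 4 → ZMod L) → (Fin 4 → ZMod L) → ℝ := fun x y => Real.sqrt (∑ k : Fin 4, (((x k - y k).valMinAbs : ℤ) : ℝ) ^ 2); (∀ n : ℕ, 1 ≤ n → 8 * n ≤ L → c * Γ ((n : ℝ) * a β) ≤ (n : ℝ) ^ 8 * cov (P 0 0 1) (P (Pi.single (2 :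 Fin 4) ((n : ℕ) : ZMod L)) 0 1) ∧ (n : ℝ) ^ 8 * cov (P 0 0 1) (P (Pi.single (2 : Fin 4) ((n : ℕ) : ZMod L)) 0 1) ≤ C * Γ ((n : ℝ) * a β)) ∧ (∀ (x y : Fin 4 → ZMod L) (i j i' j' : Fin 4), x ≠ y → i ≠ j → i' ≠ j' → |cov (P x i j) (P y i' j')| * dist x y ^ 8 ≤ C * Γ (dist x y * a β))) ∧ (∃ (β₁ ℓ₁ u₁ : ℝ), 0 < ℓ₁ ∧ 0 < u₁ ∧ ∀ (L : ℕ) [NeZero L] (β : ℝ) (n : ℕ), β₁ ≤ β → (L : ℝ) * a β ≤ ℓ₁ → 1 ≤ n → 8 * n ≤ L → let P : (Fin 4 → ZMod L) → Fin 4 → Fin 4 → GaugeConfig 4 L G → ℝ := fun x i j U => (r.N : ℝ) - (r.ρ (plaquetteHolonomy U x i j)).trace.re; let E : (GaugeConfig 4 L G → ℝ) → ℝ := fun F => wilsonExpectation (d := 4) (L := L) r.ρ β F; let cov : (GaugeConfig 4 L G → ℝ) → (GaugeConfig 4 L G → ℝ) → ℝ := fun F F' => E (fun U => F U * F' U) -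 E F * E F'; let Ga : ℝ := ∑ k : Fin 4 → ZMod L, (if k = 0 then 0 else ((2 - 2 * Real.cos (2 * Real.pi * ((k 0).val : ℝ) / L)) + (2 - 2 * Real.cos (2 * Real.pi * ((k 1).val : ℝ) / L))) / ((2 - 2 * Real.cos (2 * Real.pi * ((k 0).val : ℝ) / L)) + (2 - 2 * Real.cos (2 * Real.pi * ((k 1).val : ℝ) / L)) + (2 - 2 * Real.cos (2 * Real.pi * ((k 2).val : ℝ) / L)) + (2 - 2 * Real.cos (2 * Real.pi * ((k 3).val : ℝ) / L)))) * Real.cos (2 * Real.pi * ((k 2).val : ℝ) * n / L); let Gd : ℝ := ∑ k : Fin 4 → ZMod L, (if k = 0 then 0 else ((2 - 2 * Real.cos (2 * Real.pi * ((k 0).val : ℝ) / L)) + (2 - 2 * Real.cos (2 * Real.pi * ((k 1).val : ℝ) / L))) / ((2 - 2 * Real.cos (2 * Real.pi * ((k 0).val : ℝ) / L)) + (2 - 2 * Real.cos (2 * Real.pi * ((k 1).val : ℝ) / L)) + (2 - 2 * Real.cos (2 * Real.pi * ((k 2).val : ℝ) / L)) + (2 - 2 * Real.cos (2 * Real.pi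 * ((k 3).val : ℝ) / L)))) * Real.cos (2 * Real.pi * (((k 3).val : ℝ) - ((k 2).val : ℝ)) * n / L); let K3 : ℝ := E (fun U => P 0 0 1 U * P (Pi.single (2 : Fin 4) ((n : ℕ) : ZMod L)) 0 1 U * P (Pi.single (3 : Fin 4) ((n : ℕ) : ZMod L)) 0 1 U) - E (P 0 0 1) * cov (P (Pi.single (2 : Fin 4) ((n : ℕ) : ZMod L)) 0 1) (P (Pi.single (3 : Fin 4) ((n : ℕ) : ZMod L)) 0 1) - E (P (Pi.single (2 : Fin 4) ((n : ℕ) : ZMod L)) 0 1) * cov (P 0 0 1) (P (Pi.single (3 : Fin 4) ((n : ℕ) : ZMod L)) 0 1) - E (P (Pi.single (3 : Fin 4) ((n : ℕ) : ZMod L)) 0 1) * cov (P 0 0 1) (P (Pi.single (2 : Fin 4) ((n : ℕ) : ZMod L)) 0 1) - E (P 0 0 1) * E (P (Pi.single (2 : Fin 4) ((n : ℕ) : ZMod L)) 0 1) * E (P (Pi.single (3 : Fin 4) ((n : ℕ) : ZMod L)) 0 1); let C2 : ℝ := cov (P 0 0 1) (P (Pi.single (2 : Fin 4) ((n : ℕ)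 : ZMod L)) 0 1); u₁ ≤ K3 * Ga / (C2 ^ (3 / 2 : ℝ) * Gd))

/-! ## Bridges: item texts ⟷ the line's Theorems-side statements -/

/-- The engine-form item IS `PressureDominanceC` (modulo the landed `PressureCGF` identities and `BorelSpace` bookkeeping). -/
theorem treeDominanceItem_iff_pressureDominanceC : FemtoSkewnessTreeDominanceItem ↔ PressureDominanceC := by
  constructor
  · intro h G _ _ _ _ m hB hG r hex
    obtain ⟨hm⟩ := hB
    subst hm
    letI : MeasurableSpace G := borel G
    haveI : BorelSpace G := ⟨rfl⟩
    obtain ⟨a, ha, hP, β₁, ℓ₁, θ, d, hℓ₁, hθ0, hθ1, hd, H⟩ := h G hG r hex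
    refine ⟨a, ha, hP, β₁, ℓ₁, θ, d, hℓ₁, hθ0, hθ1, hd, fun L _ β hβ hL n hn h8 => ?_⟩
    obtain ⟨lam, hlam, h3, h2⟩ := H L β hβ hL n hn h8
    obtain ⟨hI3, hI2⟩ := pressureCGF_holds G r L β n
    have e3 : -D3 r L β n = kappa3 r L β n := by
      show -(D3 r L β n) = kappa3 r L β n
      rw [show D3 r L β n = -kappa3 r L β n from hI3, neg_neg]
    have e2 : D2 r L β n = covAxis r L β n := hI2
    refine ⟨lam, hlam, ?_, ?_⟩
    · rw [e3]; exact h3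
    · rw [e2]; exact h2
  · intro h G _ _ _ _ hG
    letI : MeasurableSpace G := borel G
    haveI : BorelSpace G := ⟨rfl⟩
    intro r hex
    obtain ⟨a, ha, hP, β₁, ℓ₁, θ, d, hℓ₁, hθ0, hθ1, hd, H⟩ := h G hG r hex
    refine ⟨a, ha, hP, β₁, ℓ₁, θ, d, hℓ₁, hθ0, hθ1, hd, fun L _ β hβ hL n hn h8 => ?_⟩
    obtain ⟨lam, hlam, h3, h2⟩ := H L β hβ hL n hn h8
    obtain ⟨hI3, hI2⟩ := pressureCGF_holds G r L β n
    have e3 : -D3 r L β n = kappa3 r L β n := by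
      show -(D3 r L β n) = kappa3 r L β n
      rw [show D3 r L β n = -kappa3 r L β n from hI3, neg_neg]
    have e2 : D2 r L β n = covAxis r L β n := hI2
    rw [e3] at h3
    rw [e2] at h2
    exact ⟨lam, hlam, h3, h2⟩

/-- The corollary-form item IS the registered stub `RatioFloorC` (`→`: move the floor from the item's map to the given continuous package
map by the landed ruler rigidity; `←`: answer with the hypothesis map itself). -/
theorem ratioFloorItem_iff_ratioFloorC : FemtoSkewRatioFloorItem ↔ RatioFloorC := by
  constructor
  · intro h G _ _ _ _ m hB hG r a₀ ha₀ hP₀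
    obtain ⟨hm⟩ := hB
    subst hm
    letI : MeasurableSpace G := borel G
    haveI : BorelSpace G := ⟨rfl⟩
    obtain ⟨a, ha, hP, hF⟩ := h G hG r ⟨a₀, ha₀, hP₀⟩
    obtain ⟨K, β₃, hK, hKβ⟩ := continuous_package_maps_comparable r hP₀ hP ha₀ ha
    exact ratioFloor_of_dominated r hF ⟨K, β₃, hK, fun β hβ => (hKβ β hβ).1⟩
  · intro h G _ _ _ _ hG
    letI : MeasurableSpace G := borel G
    haveI : BorelSpace G := ⟨rfl⟩
    intro r hex
    obtain ⟨a₀, ha₀, hP₀⟩ := hex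
    exact ⟨a₀, ha₀, hP₀, h G hG r a₀ ha₀ hP₀⟩

/-- Engine-form item ⇒ corollary-form item. -/
theorem ratioFloorItem_of_treeDominanceItem (h : FemtoSkewnessTreeDominanceItem) : FemtoSkewRatioFloorItem :=
  ratioFloorItem_iff_ratioFloorC.2 (ratioFloorC_of_pressureDominanceC (treeDominanceItem_iff_pressureDominanceC.1 h))

/-- **The corollary-form item closes the crux BY NAME.** -/
theorem femtoCurvatureSkewnessC_of_ratioFloorItem (h : FemtoSkewRatioFloorItem) : FemtoCurvatureSkewnessC :=
  femtoCurvatureSkewnessC_of_ratioFloorC (ratioFloorItem_iff_ratioFloorC.1 h)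

/-- **The engine-form item closes the crux BY NAME.** -/
theorem femtoCurvatureSkewnessC_of_treeDominanceItem (h : FemtoSkewnessTreeDominanceItem) : FemtoCurvatureSkewnessC :=
  femtoCurvatureSkewnessC_of_pressureDominanceC (treeDominanceItem_iff_pressureDominanceC.1 h)

end Summit.QuantumFields.YangMills.Cruxes.FemtoCurvatureSkewnessC.RatioTransport

end
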